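import Summits.ResolutionOfSingularities.ResolutionOfSingularities.Theorems.PurelyInseparableDim4ResConeLightWeights
import HarnessLib
import HarnessLib.Audit.Tags

/-!
# Purely inseparable four-folds — LIGHT-PAIR WEIGHTS at `p = 5`, `d = 4`: `o ≡ 6`, exactly two boundary
# letters of weight `1` (K2(p) lane, slice B, entry bookkeeping of the C∞ regime; cell `res-dim4-pi`)

[OURS · counted 0 · cell `res-dim4-pi` · K2(p) lane (holder res-dim4-p-12 g3); the `d = 4` analogue of
res-dim4-p-9 g3's K26a `light_weights` (LEMMA H of res-dim4-idea-4 g3), seat res-dim4-p-2 g4 (offer K28 (a)).]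
Pure `(r, j, b)` bookkeeping plus the chain dress; nothing here proves K2(p)/K2(5), `NoIsolatedTrap p p` or
resolution of singularities in dimension ≥ 4 / characteristic `p`.  AI kernel work, weaker than expert review.

At `p = 5`, shade `d = 4`: `o_k = |r_k| + 4 ∈ {6, 7, 8}`, the new letter weighs `o_k − 5 = |r_k| − 1`, and the
boundary law is `r_{k+1} = (r_k|_{b_k = 0}).update (j_k) (|r_k| − 1)`.
* §1 generic step bookkeeping with an arbitrary new weight `v` (`law_apply_of_update`, `degree_succ_add_le_of_hit'`,
  `apply_succ_self_of_update`, `apply_succ_kept_of_update`).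
* §2 the core at `d = 4`: **`three_le_degree_succ`** (LEMMA H′: `|r_k| ≥ 3 ⇒ |r_{k+1}| ≥ 3` — the heavy newest
  letter cannot be kept (a satellite step, light ⇒ `|r_k| + |r_{k+1}| ≤ 4`) and hitting it drops below the floor),
  `degree_eq_two` (with the upper-run exclusion), **`light_pair_weights_core`**: `∀ k ≥ k₀, weights ≤ 1 ∧ |r_k| = 2`
  (a weight-`2` letter can be neither kept — `|r_{k+1}| ≥ 3` — nor hit — `|r_{k+1}| ≤ 1`).
* §3 the dress **`light_pair_weights`**: witnessed isolated above-floor `Step0 5` chain of constant shade `4` from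
  `k₀`, light bound `o_k + o_{k+1} + 3 ≤ 15` at every satellite step `k ≥ k₀` (res-dim4-p-2 g4's K27a
  `satellite_light_of_powerCone`) ⊢ `∀ k ≥ k₀, (∀ i, r_k i ≤ 1) ∧ |r_k| = 2` (upper run `o ≥ 7` excluded by
  `BandLayers.no_isolated_chain_eventually_upper`); hence `(c k).r.support.card = 2` (`light_pair_card_two`).
bears_on: LADDER-RESOLUTION:D157-DOOR2 (res-dim4-pi · K2(p) · slice B · C∞ entry).  Supports
stmt-ResolutionOfSingularities-16155 (helper).
-/

set_option linter.dupNamespace false -- mandated namespace of this single-conjunct summit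

noncomputable section

namespace Summit.ResolutionOfSingularities.ResolutionOfSingularities.Theorems.PIDim4

namespace ResCone

open MvPolynomial Finset
open Literature.AlgebraicGeometry.Resolution
open Literature.AlgebraicGeometry.Resolution.CentreBlowup
open Literature.AlgebraicGeometry.Resolution.Hauser2010
open Literature.AlgebraicGeometry.Resolution.HauserPerlega2019

variable {K : Type} [Field K] [DecidableEq K]

/-! ## 1. Step bookkeeping with an arbitrary new weight -/

section Step

variable {r : ℕ → Fin 4 →₀ ℕ} {j : ℕ → Fin 4} {b : ℕ → Fin 4 → K} {k v : ℕ}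

/-- The boundary law read letterwise. [folklore] -/
theorem law_apply_of_update (hlaw : r (k + 1) = ((r k).filter (fun i => b k i = 0)).update (j k) v) (i : Fin 4) :
    r (k + 1) i = if i = j k then v else if b k i = 0 then r k i else 0 := by
  rw [hlaw, Finsupp.coe_update]
  by_cases hij : i = j k
  · rw [if_pos hij, hij, Function.update_self]
  · rw [if_neg hij, Function.update_of_ne hij, Finsupp.filter_apply]

/-- The new letter gets the new weight. [folklore] -/
theorem apply_succ_self_of_update (hlaw : r (k + 1) = ((r k).filter (fun i => b k i = 0)).update (j k) v) :
    r (k + 1) (j k) = v := by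
  rw [law_apply_of_update hlaw, if_pos rfl]

/-- A kept letter keeps its weight. [folklore] -/
theorem apply_succ_kept_of_update (hlaw : r (k + 1) = ((r k).filter (fun i => b k i = 0)).update (j k) v)
    {i : Fin 4} (hij : j k ≠ i) (hb : b k i = 0) : r (k + 1) i = r k i := by
  rw [law_apply_of_update hlaw, if_neg (Ne.symm hij), if_pos hb]

/-- **The degree after a step, bounded through a HIT letter**: `|r_{k+1}| + r_k N ≤ v + |r_k|` for any `N` hit by
the step (`N = j k` or `b k N ≠ 0`), using `b k (j k) = 0`. [folklore] -/
theorem degree_succ_add_le_of_hit' (hlaw : r (k + 1) = ((r k).filter (fun i => b k i = 0)).update (j k) v)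
    (hbj : b k (j k) = 0) {N : Fin 4} (hN : j k = N ∨ b k N ≠ 0) :
    (r (k + 1)).degree + r k N ≤ v + (r k).degree := by
  set f : Fin 4 →₀ ℕ := (r k).filter (fun i => b k i = 0) with hf
  set g : Fin 4 →₀ ℕ := (r k).filter (fun i => ¬ b k i = 0) with hg
  have h1 : (r (k + 1)).degree + f (j k) = f.degree + v := by
    have e1 : r (k + 1) = f.erase (j k) + Finsupp.single (j k) v := by
      rw [hlaw, Finsupp.update_eq_erase_add_single]
    have e2 : f = f.erase (j k) + Finsupp.single (j k) (f (j k)) := (Finsupp.erase_add_single (j k) f).symm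
    have d1 := congrArg Finsupp.degree e1
    have d2 := congrArg Finsupp.degree e2
    rw [map_add, Finsupp.degree_single] at d1 d2
    omega
  have h2 : f.degree + g.degree = (r k).degree := by
    rw [← map_add, hf, hg, Finsupp.filter_add_filter_not]
  have hfj : f (j k) = r k (j k) := by rw [hf, Finsupp.filter_apply, if_pos hbj]
  rcases hN with hN | hN
  · subst hN; omega
  · have hgN : r k N ≤ g.degree := by
      have h3 : g N = r k N := by rw [hg, Finsupp.filter_apply, if_pos hN]
      rw [← h3]
      exact Finsupp.le_degree N g
    omega

end Step

/-- Two distinct letters weigh at most the degree. [folklore] -/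
private theorem apply_add_apply_le_degree' (f : Fin 4 →₀ ℕ) {a a' : Fin 4} (haa : a ≠ a') : f a + f a' ≤ f.degree := by
  classical
  rw [Finsupp.degree_eq_sum]
  have h := Finset.sum_le_sum_of_subset (f := fun i => f i) (Finset.subset_univ ({a, a'} : Finset (Fin 4)))
  rwa [Finset.sum_pair haa] at h

/-! ## 2. The core at `d = 4` -/

section Core

variable {r : ℕ → Fin 4 →₀ ℕ} {j : ℕ → Fin 4} {b : ℕ → Fin 4 → K} {k₀ : ℕ}

/-- **LEMMA H′ (`d = 4`): a heavy newest letter is fatal — `|r_k| ≥ 3 ⇒ |r_{k+1}| ≥ 3`.**  The newest letter weighs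
`|r_k| − 1 ≥ 2`; keeping it at step `k + 1` is a satellite step, against the light bound `|r_k| + |r_{k+1}| ≤ 4`;
hitting it leaves `|r_{k+2}| ≤ 1`, below the floor — unless `|r_{k+1}| ≥ 3`. [OURS] [folklore] -/
theorem three_le_degree_succ
    (hlaw : ∀ k, k₀ ≤ k → r (k + 1) = ((r k).filter (fun i => b k i = 0)).update (j k) ((r k).degree - 1))
    (hbj : ∀ k, b k (j k) = 0) (hfloor : ∀ k, k₀ ≤ k → 2 ≤ (r k).degree)
    (hlight : ∀ k, k₀ ≤ k → FreeTail.IsSatellite j b k → (r k).degree + (r (k + 1)).degree ≤ 4)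
    {k : ℕ} (hk : k₀ ≤ k) (h3 : 3 ≤ (r k).degree) : 3 ≤ (r (k + 1)).degree := by
  by_contra hlt
  have hnsat : ¬ FreeTail.IsSatellite j b k := fun hsat => by
    have := hlight k hk hsat; have := hfloor (k + 1) (by omega); omega
  have hhit : j (k + 1) = j k ∨ b (k + 1) (j k) ≠ 0 := by
    by_contra h
    push Not at h
    exact hnsat ⟨h.1, h.2⟩
  have h1 := degree_succ_add_le_of_hit' (hlaw (k + 1) (by omega)) (hbj (k + 1)) hhit
  rw [apply_succ_self_of_update (hlaw k hk)] at h1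
  have h2 := hfloor (k + 1 + 1) (by omega)
  omega

/-- **`|r_k| = 2` on the tail**, given that upper runs `|r| ≥ 3` do not last for ever. [folklore] -/
theorem degree_eq_two
    (hlaw : ∀ k, k₀ ≤ k → r (k + 1) = ((r k).filter (fun i => b k i = 0)).update (j k) ((r k).degree - 1))
    (hbj : ∀ k, b k (j k) = 0) (hfloor : ∀ k, k₀ ≤ k → 2 ≤ (r k).degree)
    (hlight : ∀ k, k₀ ≤ k → FreeTail.IsSatellite j b k → (r k).degree + (r (k + 1)).degree ≤ 4)
    (hupper : ∀ k₁, k₀ ≤ k₁ → ∃ k, k₁ ≤ k ∧ (r k).degree ≤ 2) {k : ℕ} (hk : k₀ ≤ k) : (r k).degree = 2 := by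
  refine le_antisymm ?_ (hfloor k hk)
  by_contra h3
  have hrun : ∀ n, 3 ≤ (r (k + n)).degree := by
    intro n
    induction n with
    | zero => simpa using (by omega : 3 ≤ (r k).degree)
    | succ n ih =>
      have h := three_le_degree_succ hlaw hbj hfloor hlight (k := k + n) (by omega) ih
      simpa only [Nat.add_succ] using h
  obtain ⟨k', hk', hle⟩ := hupper k hk
  obtain ⟨n, rfl⟩ := Nat.exists_eq_add_of_le hk'
  have := hrun n
  omega

/-- **LIGHT-PAIR WEIGHTS, core**: under the `d = 4` law, the floor, the light bound at satellite steps and the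
upper-run exclusion, every boundary weight is `≤ 1` and `|r_k| = 2` from `k₀` on (a weight-`2` letter can be
neither kept — the new letter would make `|r| ≥ 3` — nor hit — `|r| ≤ 1`). [OURS] [folklore] -/
theorem light_pair_weights_core
    (hlaw : ∀ k, k₀ ≤ k → r (k + 1) = ((r k).filter (fun i => b k i = 0)).update (j k) ((r k).degree - 1))
    (hbj : ∀ k, b k (j k) = 0) (hfloor : ∀ k, k₀ ≤ k → 2 ≤ (r k).degree)
    (hlight : ∀ k, k₀ ≤ k → FreeTail.IsSatellite j b k → (r k).degree + (r (k + 1)).degree ≤ 4)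
    (hupper : ∀ k₁, k₀ ≤ k₁ → ∃ k, k₁ ≤ k ∧ (r k).degree ≤ 2) :
    ∀ k, k₀ ≤ k → (∀ i, r k i ≤ 1) ∧ (r k).degree = 2 := by
  have h2 : ∀ k, k₀ ≤ k → (r k).degree = 2 := fun k hk => degree_eq_two hlaw hbj hfloor hlight hupper hk
  intro k hk
  refine ⟨fun W => ?_, h2 k hk⟩
  by_contra hW
  have hW2 : 2 ≤ r k W := by omega
  by_cases hhit : j k = W ∨ b k W ≠ 0
  · -- hit: `|r_{k+1}| + 2 ≤ 1 + 2`
    have h := degree_succ_add_le_of_hit' (hlaw k hk) (hbj k) hhit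
    have := h2 (k + 1) (by omega); have := h2 k hk; omega
  · -- kept: `W` and the new letter both alive at `k + 1`
    push Not at hhit
    have hkept := apply_succ_kept_of_update (hlaw k hk) hhit.1 hhit.2
    have hnew := apply_succ_self_of_update (hlaw k hk)
    have hle := apply_add_apply_le_degree' (r (k + 1)) hhit.1
    rw [hnew, hkept, h2 k hk] at hle
    have := h2 (k + 1) (by omega)
    omega

end Core

/-! ## 3. The dress at `p = 5`, `d = 4` -/

section Chain

variable [CharP K 5]

/-- **LIGHT-PAIR WEIGHTS** (`p = 5`, `d = 4`): along a witnessed isolated above-floor `Step0 5` chain of constant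
shade `4` from `k₀`, GIVEN the light bound `o_k + o_{k+1} + 3 ≤ 15` at every satellite step `k ≥ k₀`, every
boundary weight is `≤ 1` and `|r_k| = 2` from `k₀` on (`o ≡ 6`, two boundary letters of weight `1`). [OURS]
[folklore] -/
theorem light_pair_weights {c : ℕ → State K} {j : ℕ → Fin 4} {b : ℕ → Fin 4 → K}
    (hc : ∀ k, IsIsolated 5 (c k).F ∧ Step0 5 (c k) (c (k + 1))) (hw : FreeTail.IsWitnessedChain 5 c j b)
    (hfloor : ∀ k, ordZero (c k).F ≠ 5) {k₀ : ℕ} (hshade : ∀ k, k₀ ≤ k → (c k).shade = ((4 : ℕ) : ℕ∞))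
    (hlight : ∀ k, k₀ ≤ k → FreeTail.IsSatellite j b k → ∀ oₖ oₖ₁ : ℕ,
      ordZero (c k).F = oₖ → ordZero (c (k + 1)).F = oₖ₁ → oₖ + oₖ₁ + 3 ≤ 15) :
    ∀ k, k₀ ≤ k → (∀ i, (c k).r i ≤ 1) ∧ (c k).r.degree = 2 := by
  haveI : Fact (Nat.Prime 5) := ⟨by norm_num⟩
  -- `o_k = |r_k| + 4` on the tail
  have hord : ∀ k, k₀ ≤ k → ordZero (c k).F = (((c k).r.degree + 4 : ℕ) : ℕ∞) := by
    intro k hk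
    obtain ⟨o, ho, hpo, -, hd⟩ := chain_shade_nat 5 hc hfloor hshade hk
    rw [ho]; congr 1; omega
  have hlaw : ∀ k, k₀ ≤ k →
      (c (k + 1)).r = ((c k).r.filter (fun i => b k i = 0)).update (j k) ((c k).r.degree - 1) := by
    intro k hk
    rw [(hw k).2.2.2.2, step_r_univ' 5 (j k) (b k) (c k) (hord k hk)]
    congr 1
  have hbj : ∀ k, b k (j k) = 0 := fun k => (hw k).2.1
  have hfloor' : ∀ k, k₀ ≤ k → 2 ≤ (c k).r.degree := by
    intro k hk
    obtain ⟨o, ho, hpo, -, hd⟩ := chain_shade_nat 5 hc hfloor hshade hk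
    omega
  have hlight' : ∀ k, k₀ ≤ k → FreeTail.IsSatellite j b k → (c k).r.degree + (c (k + 1)).r.degree ≤ 4 := by
    intro k hk hsat
    have h := hlight k hk hsat _ _ (hord k hk) (hord (k + 1) (by omega))
    omega
  have hupper : ∀ k₁, k₀ ≤ k₁ → ∃ k, k₁ ≤ k ∧ (c k).r.degree ≤ 2 := by
    intro k₁ hk₁
    by_contra hno
    push Not at hno
    refine BandLayers.no_isolated_chain_eventually_upper 5 hc (k₀ := k₁) fun k hk => ?_
    rw [hord k (le_trans hk₁ hk)]
    have := hno k hk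
    exact_mod_cast (by norm_num; omega)
  exact light_pair_weights_core hlaw hbj hfloor' hlight' hupper

/-- Hence **exactly two boundary letters** from `k₀` on. [folklore] -/
theorem light_pair_card_two {c : ℕ → State K} {j : ℕ → Fin 4} {b : ℕ → Fin 4 → K}
    (hc : ∀ k, IsIsolated 5 (c k).F ∧ Step0 5 (c k) (c (k + 1))) (hw : FreeTail.IsWitnessedChain 5 c j b)
    (hfloor : ∀ k, ordZero (c k).F ≠ 5) {k₀ : ℕ} (hshade : ∀ k, k₀ ≤ k → (c k).shade = ((4 : ℕ) : ℕ∞))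
    (hlight : ∀ k, k₀ ≤ k → FreeTail.IsSatellite j b k → ∀ oₖ oₖ₁ : ℕ,
      ordZero (c k).F = oₖ → ordZero (c (k + 1)).F = oₖ₁ → oₖ + oₖ₁ + 3 ≤ 15) {k : ℕ} (hk : k₀ ≤ k) :
    (c k).r.support.card = 2 := by
  classical
  obtain ⟨h1, hdeg⟩ := light_pair_weights hc hw hfloor hshade hlight k hk
  have hsupp : (c k).r.support = Finset.univ.filter (fun i => (c k).r i = 1) := by
    ext i
    rw [Finsupp.mem_support_iff, Finset.mem_filter]
    have := h1 i
    constructor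
    · intro h; exact ⟨Finset.mem_univ i, by omega⟩
    · intro h; omega
  have hsum : (c k).r.degree = ∑ i, (c k).r i := Finsupp.degree_eq_sum _
  have key : ∑ i, (c k).r i = (Finset.univ.filter (fun i => (c k).r i = 1)).card := by
    rw [Finset.card_eq_sum_ones, Finset.sum_filter]
    exact Finset.sum_congr rfl fun i _ => by have := h1 i; split_ifs with h <;> omega
  rw [hsupp]
  omega

end Chain

end ResCone

end Summit.ResolutionOfSingularities.ResolutionOfSingularities.Theorems.PIDim4

end
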